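/-
Copyright (c) 2026 the pub-hodgecm-mathlib formalisation cell (harness21).  Prover seat hodgecm-mathlib-K2E4-p08 (g2), Track B «K2-LIT» ∕ h413,
‹S› ROAD J brick J2♯, RAMIFIED LEAF: the coset witnesses and the index inequality at the vertex ∕ edge levels of a ramified non-split place.  2026-09-04.
-/
import Literature.NumberTheory.Rogawski1990.RankOneEulerPoincareNonsplitCentralValueUnramified   -- ★ p855639 (this seat): §0 one-place lemmas, (W1) pattern
import Literature.NumberTheory.Rogawski1990.RankOneEulerPoincareNonsplitRamifiedPackage           -- ★ the levels `K♯_D`, `K♯_D ⊓ K`: membership, compact, open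
import Literature.NumberTheory.Automorphic.RamifiedPlaceAntiFixedDichotomy                        -- ★ the anti-fixed `α ∈ L_wˣ`: unit or uniformiser
import HarnessLib

/-!
# (R2♯) at the RAMIFIED non-split places, I: coset witnesses and `1∕vol K♯ + 1∕vol K < 1∕vol (K♯ ⊓ K)` — road J brick J2♯, leaf 2a

At a finite place `v` of `L⁺` RAMIFIED in the CM field `L` (`w ∣ v`, `w̄ = w`, `e(w|v) ≠ 1`) the one-place model `U_w = U(σ_w, J)(L_w)`, `J = !![0,1;1,0]`, of
`U₂ = U(Φ₂)(L⁺_v)` acts on the barycentric subdivision of its Bruhat–Tits tree with the two levels `K = U_w ∩ GL₂(𝒪_w)` (★ `cmLocalIntegralLevel`) and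
`K♯_D = U_w ∩ D GL₂(𝒪_w) D⁻¹`, `D = D_η = diag(1, η)` for a uniformiser `η` of `L_w` (★ `RankOneEulerPoincareNonsplitRamifiedPackage`), meeting in the flag
level `K♯_D ⊓ K` ([Kottwitz1988, §2], [Serre1980Trees, II.1.1–1.3], [Tits1979, §2.7]).  One of `K`, `K♯_D` is a vertex stabiliser (index `q_v + 1 ≥ 3` over the
flag level), the other an edge stabiliser with inversion (index `2`); WHICH is decided by the anti-fixed dichotomy ★
`exists_units_galAdicCompletionMap_complexConj_eq_neg_of_ramified` (`α ∈ L_wˣ`, `σ_w α = −α`, a UNIT — the wild `F_v(√u)`-type — or a UNIFORMISER — every tame place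
and the wild `F_v(√π)`-type).  This file supplies EXPLICIT ONE-PLACE COSET WITNESSES in both cases and deduces the index inequality
`1∕vol K♯_D + 1∕vol K < 1∕vol (K♯_D ⊓ K)` (★ `toReal_inv_add_toReal_inv_lt_of_witnesses`, p855541), the hypothesis `hidx` of the glue WITH VALUE ★
`exists_isLocSmooth_classOrbitalIntegral_eq_one_zero_and_apply_neg_of_relations` (p855520), together with (W1) «central unit scalars lie in all three levels»:
* `α` a unit `t`: `1, J, u(t) = !![1,0;t,1] ∈ K` pairwise inequivalent modulo `K♯_D`, and `x_η = !![0,η⁻¹;σ_w η,0] ∈ K♯_D ∖ K`;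
* `α` a uniformiser, `b = α⁻¹`: `1, n(b) = !![1,b;0,1], x_η ∈ K♯_D` pairwise inequivalent modulo `K`, and `J ∈ K ∖ K♯_D`.
Leaf 2b (the letter with its negative central value at a ramified place, from (E) and (N) at these levels) and the all-places assembly follow in the next file.

HONEST LABEL: a Literature-side helper toward h413 (`stmt-HodgeConjecture-24833`); HC_CM is proved only modulo its printed citations until rung 0 closes.
-/

set_option autoImplicit false

noncomputable section

open scoped ValuativeRel Matrix MatrixGroups ENNReal
open Matrix NumberField IsDedekindDomain MulAction MeasureTheory Measure

namespace Literature.NumberTheory.Rogawski1990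

open Literature.NumberTheory.Automorphic Literature.NumberTheory.Automorphic.UnitaryGroup Literature.NumberTheory.GaloisRepresentations
open Literature.MeasureTheory.Group
open Literature.NumberTheory.Automorphic.HermitianLatticeTree (mem_glInt_iff_forall_v_le_one_and_v_det_eq_one)

/-! ## §0 More one-place matrix algebra: the upper unipotent, the `η`-antidiagonal `x_η`, conjugation by `D_η = diag(1, η)` -/

section OnePlace

variable {F : Type*} [Field F] (σ : F →+* F)

/-- `n(b) n(−b) = 1` for the upper unipotents. [cite: Rogawski1990, §1.10 p. 9] -/
theorem upperUnipTwo_mul_neg (b : F) : (!![(1 : F), b; 0, 1] : Matrix (Fin 2) (Fin 2) F) * !![(1 : F), -b; 0, 1] = 1 := by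
  ext i j; fin_cases i <;> fin_cases j <;> simp

/-- The upper unipotent `n(b)` is unitary for `(σ, J)` when `σ b = −b`. [cite: Rogawski1990, §1.10 p. 9] -/
theorem upperUnipTwo_unitary {b : F} (hσb : σ b = -b) :
    ((!![(1 : F), b; 0, 1] : Matrix (Fin 2) (Fin 2) F).map σ)ᵀ * !![(0 : F), 1; 1, 0] * !![(1 : F), b; 0, 1] = !![(0 : F), 1; 1, 0] := by
  ext i j; fin_cases i <;> fin_cases j <;> simp [Matrix.mul_apply, Fin.sum_univ_two, hσb]

/-- `!![0,η⁻¹;c,0] · !![0,c⁻¹;η,0] = 1`. [cite: Serre1980Trees, II.1.1] -/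
theorem etaAntidiagTwo_mul {η c : F} (hη : η ≠ 0) (hc : c ≠ 0) :
    (!![(0 : F), η⁻¹; c, 0] : Matrix (Fin 2) (Fin 2) F) * !![(0 : F), c⁻¹; η, 0] = 1 := by
  ext i j; fin_cases i <;> fin_cases j <;> simp [hη, hc]

/-- The `η`-antidiagonal `x_η = !![0,η⁻¹;σ η,0]` is unitary for `(σ, J)` (`σ` an involution on `η`). [cite: Serre1980Trees, II.1.1] -/
theorem etaAntidiagTwo_unitary {η : F} (hη : η ≠ 0) (hσσ : σ (σ η) = η) :
    ((!![(0 : F), η⁻¹; σ η, 0] : Matrix (Fin 2) (Fin 2) F).map σ)ᵀ * !![(0 : F), 1; 1, 0] * !![(0 : F), η⁻¹; σ η, 0] = !![(0 : F), 1; 1, 0] := by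
  have hση : σ η ≠ 0 := by simpa using hη
  ext i j; fin_cases i <;> fin_cases j <;> simp [Matrix.mul_apply, Fin.sum_univ_two, hσσ, map_inv₀, hη, hση]

/-- `D_η⁻¹ J D_η = !![0,η;η⁻¹,0]`. [cite: Serre1980Trees, II.1.1] -/
theorem diagonal_conj_antidiagTwo (η : F) :
    Matrix.diagonal ![(1 : F), η⁻¹] * !![(0 : F), 1; 1, 0] * Matrix.diagonal ![(1 : F), η] = !![(0 : F), η; η⁻¹, 0] := by
  ext i j; fin_cases i <;> fin_cases j <;> simp [Matrix.mul_apply, Fin.sum_univ_two]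

/-- `D_η⁻¹ u(t) D_η = !![1,0;η⁻¹t,1]`. [cite: Serre1980Trees, II.1.1] -/
theorem diagonal_conj_lowerUnipTwo (t η : F) :
    Matrix.diagonal ![(1 : F), η⁻¹] * !![(1 : F), 0; t, 1] * Matrix.diagonal ![(1 : F), η] = !![(1 : F), 0; η⁻¹ * t, η⁻¹ * η] := by
  ext i j; fin_cases i <;> fin_cases j <;> simp [Matrix.mul_apply, Fin.sum_univ_two]

/-- `D_η⁻¹ (J u(t)) D_η = !![t,η;η⁻¹,0]`. [cite: Serre1980Trees, II.1.1] -/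
theorem diagonal_conj_antidiagTwo_mul_lowerUnipTwo (t η : F) :
    Matrix.diagonal ![(1 : F), η⁻¹] * ((!![(0 : F), 1; 1, 0] : Matrix (Fin 2) (Fin 2) F) * !![(1 : F), 0; t, 1]) * Matrix.diagonal ![(1 : F), η] =
      !![t, η; η⁻¹, 0] := by
  ext i j; fin_cases i <;> fin_cases j <;> simp [Matrix.mul_apply, Fin.sum_univ_two]

/-- `D_η⁻¹ n(b) D_η = !![1,bη;0,1]`. [cite: Serre1980Trees, II.1.1] -/
theorem diagonal_conj_upperUnipTwo (b : F) {η : F} (hη : η ≠ 0) :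
    Matrix.diagonal ![(1 : F), η⁻¹] * !![(1 : F), b; 0, 1] * Matrix.diagonal ![(1 : F), η] = !![(1 : F), b * η; 0, 1] := by
  ext i j; fin_cases i <;> fin_cases j <;> simp [Matrix.mul_apply, Fin.sum_univ_two, hη]

/-- `D_η⁻¹ x_η D_η = !![0,1;η⁻¹c,0]` (`x_η = !![0,η⁻¹;c,0]`). [cite: Serre1980Trees, II.1.1] -/
theorem diagonal_conj_etaAntidiagTwo (c : F) {η : F} (hη : η ≠ 0) :
    Matrix.diagonal ![(1 : F), η⁻¹] * !![(0 : F), η⁻¹; c, 0] * Matrix.diagonal ![(1 : F), η] = !![(0 : F), 1; η⁻¹ * c, 0] := by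
  ext i j; fin_cases i <;> fin_cases j <;> simp [Matrix.mul_apply, Fin.sum_univ_two, hη]

/-- `n(−b) x_η = !![−bc,η⁻¹;c,0]`. [cite: Serre1980Trees, II.1.1] -/
theorem upperUnipTwo_neg_mul_etaAntidiagTwo (b η c : F) :
    (!![(1 : F), -b; 0, 1] : Matrix (Fin 2) (Fin 2) F) * !![(0 : F), η⁻¹; c, 0] = !![-b * c, η⁻¹; c, 0] := by
  ext i j; fin_cases i <;> fin_cases j <;> simp [Matrix.mul_apply, Fin.sum_univ_two]

end OnePlace

/-! ## §1 One-place coset witnesses at a ramified place: the two types -/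

section Witnesses

variable (L : Type) [Field L] [NumberField L] [IsCMField L] {v : HeightOneSpectrum (𝓞 ↥(maximalRealSubfield L))}
  (w : PlacesOver L v) (hw : IsCMField.complexConj L • w.1 = w.1)
  (η : (w.1.adicCompletion L)ˣ) (hη : Valued.v (η : w.1.adicCompletion L) = WithZero.exp (-1 : ℤ))

include hη in
/-- **TYPE `F_v(√u)` (an anti-fixed UNIT `t`): `J`, `u(t)` in `GL₂(𝒪_w) ∩ U_w`, with `J`, `u(t)`, `J⁻¹u(t)` outside `D_η GL₂(𝒪_w) D_η⁻¹`, and `x_η` in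
`D_η GL₂(𝒪_w) D_η⁻¹ ∩ U_w` outside `GL₂(𝒪_w)`** — three `K♯`-inequivalent elements of the vertex stabiliser `K` and one element of `K♯ ∖ K`.
[cite: Serre1980Trees, II.1.3] [cite: Tits1979, §2.7] [cite: Kottwitz1988, §2] -/
theorem exists_onePlaceWitnesses_of_antifixed_unit {t : w.1.adicCompletion L}
    (hσt : galAdicCompletionMap (L := L) (IsCMField.complexConj L) hw t = -t) (hvt : Valued.v t = 1) :
    ∃ u₂ u₃ x : ↥(unitaryGroupOfForm (galAdicCompletionMap (L := L) (IsCMField.complexConj L) hw)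
        (placeForm (Matrix.of fun i j : Fin 2 => if i.val + j.val + 1 = 2 then (1 : L) else 0) w.1)),
      (u₂ : GL (Fin 2) (w.1.adicCompletion L)) ∈ glInt 2 (w.1.adicCompletion L) ∧ (u₃ : GL (Fin 2) (w.1.adicCompletion L)) ∈ glInt 2 (w.1.adicCompletion L) ∧
      (u₂ : GL (Fin 2) (w.1.adicCompletion L)) ∉ (glInt 2 (w.1.adicCompletion L)).map (MulAut.conj (glDiagonal 2 (w.1.adicCompletion L) ![1, η])).toMonoidHom ∧
      (u₃ : GL (Fin 2) (w.1.adicCompletion L)) ∉ (glInt 2 (w.1.adicCompletion L)).map (MulAut.conj (glDiagonal 2 (w.1.adicCompletion L) ![1, η])).toMonoidHom ∧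
      ((u₂⁻¹ * u₃ : ↥(unitaryGroupOfForm (galAdicCompletionMap (L := L) (IsCMField.complexConj L) hw)
        (placeForm (Matrix.of fun i j : Fin 2 => if i.val + j.val + 1 = 2 then (1 : L) else 0) w.1))) : GL (Fin 2) (w.1.adicCompletion L)) ∉
          (glInt 2 (w.1.adicCompletion L)).map (MulAut.conj (glDiagonal 2 (w.1.adicCompletion L) ![1, η])).toMonoidHom ∧
      (x : GL (Fin 2) (w.1.adicCompletion L)) ∈ (glInt 2 (w.1.adicCompletion L)).map (MulAut.conj (glDiagonal 2 (w.1.adicCompletion L) ![1, η])).toMonoidHom ∧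
      (x : GL (Fin 2) (w.1.adicCompletion L)) ∉ glInt 2 (w.1.adicCompletion L) := by
  classical
  have hc1 : IsCMField.complexConj L ≠ 1 := IsCMField.complexConj_ne_one L
  have he : (ValuativeRel.valuation (w.1.adicCompletion L)).IsEquiv (Valued.v : Valuation (w.1.adicCompletion L) (WithZero (Multiplicative ℤ))) :=
    ValuativeRel.isEquiv _ _
  have hη0 : (η : w.1.adicCompletion L) ≠ 0 := η.ne_zero
  have hση0 : galAdicCompletionMap (L := L) (IsCMField.complexConj L) hw (η : w.1.adicCompletion L) ≠ 0 := by simp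
  have hσσ : galAdicCompletionMap (L := L) (IsCMField.complexConj L) hw (galAdicCompletionMap (L := L) (IsCMField.complexConj L) hw (η : w.1.adicCompletion L)) = η :=
    galAdicCompletionMap_galAdicCompletionMap_of_smul_eq (IsCMField.complexConj L) w hc1 hw _
  have hvηinv : ¬ Valued.v ((η : w.1.adicCompletion L)⁻¹) ≤ 1 := by
    rw [map_inv₀, hη, ← WithZero.exp_neg, ← WithZero.exp_zero, not_le]
    exact WithZero.exp_lt_exp.2 (by norm_num)
  have hvηση : Valued.v ((η : w.1.adicCompletion L)⁻¹ * galAdicCompletionMap (L := L) (IsCMField.complexConj L) hw (η : w.1.adicCompletion L)) = 1 := by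
    rw [map_mul, map_inv₀, valued_galAdicCompletionMap, inv_mul_cancel₀]
    rw [hη]; exact WithZero.coe_ne_zero
  have hJ : placeForm (Matrix.of fun i j : Fin 2 => if i.val + j.val + 1 = 2 then (1 : L) else 0) w.1 = !![(0 : w.1.adicCompletion L), 1; 1, 0] := by
    ext i j; fin_cases i <;> fin_cases j <;> simp [placeForm, Matrix.map_apply]
  -- the three one-place matrices
  have hJJ := antidiagTwo_mul_self (F := w.1.adicCompletion L)
  have hUU := lowerUnipTwo_mul_neg t
  have hUU' : (!![(1 : w.1.adicCompletion L), 0; -t, 1] : Matrix (Fin 2) (Fin 2) (w.1.adicCompletion L)) * !![(1 : w.1.adicCompletion L), 0; t, 1] = 1 := by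
    simpa using lowerUnipTwo_mul_neg (-t)
  have hXX := etaAntidiagTwo_mul hη0 hση0
  have hXX' := etaAntidiagTwo_mul hση0 hη0
  set G₂ : GL (Fin 2) (w.1.adicCompletion L) := ⟨_, _, hJJ, hJJ⟩ with hG₂
  set G₃ : GL (Fin 2) (w.1.adicCompletion L) := ⟨_, _, hUU, hUU'⟩ with hG₃
  set Gx : GL (Fin 2) (w.1.adicCompletion L) := ⟨_, _, hXX, hXX'⟩ with hGx
  -- unitarity
  have hmemU : ∀ g : GL (Fin 2) (w.1.adicCompletion L),
      ((g : Matrix (Fin 2) (Fin 2) (w.1.adicCompletion L)).map (galAdicCompletionMap (L := L) (IsCMField.complexConj L) hw))ᵀ *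
          !![(0 : w.1.adicCompletion L), 1; 1, 0] * (g : Matrix (Fin 2) (Fin 2) (w.1.adicCompletion L)) = !![(0 : w.1.adicCompletion L), 1; 1, 0] →
        g ∈ unitaryGroupOfForm (galAdicCompletionMap (L := L) (IsCMField.complexConj L) hw) (placeForm (Matrix.of fun i j : Fin 2 => if i.val + j.val + 1 = 2 then (1 : L) else 0) w.1) := by
    intro g hg; rw [mem_unitaryGroupOfForm_iff, hJ]; exact hg
  have hU₂ := hmemU G₂ (antidiagTwo_unitary _)
  have hU₃ := hmemU G₃ (lowerUnipTwo_unitary _ hσt)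
  have hUx := hmemU Gx (etaAntidiagTwo_unitary _ hη0 hσσ)
  -- conjugation by `D_η` on matrices
  have hconjmat : ∀ g : GL (Fin 2) (w.1.adicCompletion L),
      (((glDiagonal 2 (w.1.adicCompletion L) ![1, η])⁻¹ * g * glDiagonal 2 (w.1.adicCompletion L) ![1, η] : GL (Fin 2) (w.1.adicCompletion L)) :
        Matrix (Fin 2) (Fin 2) (w.1.adicCompletion L)) =
        Matrix.diagonal ![(1 : w.1.adicCompletion L), (η : w.1.adicCompletion L)⁻¹] * (g : Matrix (Fin 2) (Fin 2) (w.1.adicCompletion L)) *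
          Matrix.diagonal ![(1 : w.1.adicCompletion L), (η : w.1.adicCompletion L)] := by
    intro g
    rw [Units.val_mul, Units.val_mul, ← map_inv, coe_glDiagonal, coe_glDiagonal]
    have hd1 : (fun k : Fin 2 => (((![1, η] : Fin 2 → (w.1.adicCompletion L)ˣ)⁻¹ k : (w.1.adicCompletion L)ˣ) : w.1.adicCompletion L)) =
        ![(1 : w.1.adicCompletion L), (η : w.1.adicCompletion L)⁻¹] := by
      funext k; fin_cases k <;> simp
    have hd2 : (fun k : Fin 2 => (((![1, η] : Fin 2 → (w.1.adicCompletion L)ˣ) k : (w.1.adicCompletion L)ˣ) : w.1.adicCompletion L)) =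
        ![(1 : w.1.adicCompletion L), (η : w.1.adicCompletion L)] := by
      funext k; fin_cases k <;> simp
    rw [hd1, hd2]
  -- exit criteria
  have hnotK01 : ∀ g : GL (Fin 2) (w.1.adicCompletion L), ¬ Valued.v ((g : Matrix (Fin 2) (Fin 2) (w.1.adicCompletion L)) 0 1) ≤ 1 → g ∉ glInt 2 (w.1.adicCompletion L) :=
    fun g hg h => hg (((mem_glInt_iff_forall_v_le_one_and_v_det_eq_one g).1 h).1 0 1)
  have hnotS10 : ∀ g : GL (Fin 2) (w.1.adicCompletion L),
      ¬ Valued.v ((Matrix.diagonal ![(1 : w.1.adicCompletion L), (η : w.1.adicCompletion L)⁻¹] * (g : Matrix (Fin 2) (Fin 2) (w.1.adicCompletion L)) *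
          Matrix.diagonal ![(1 : w.1.adicCompletion L), (η : w.1.adicCompletion L)]) 1 0) ≤ 1 →
        g ∉ (glInt 2 (w.1.adicCompletion L)).map (MulAut.conj (glDiagonal 2 (w.1.adicCompletion L) ![1, η])).toMonoidHom := by
    intro g hg h
    have h' := ((mem_glInt_iff_forall_v_le_one_and_v_det_eq_one _).1 ((Literature.GroupTheory.mem_map_conj_iff _ _ _).1 h)).1 1 0
    rw [hconjmat] at h'
    exact hg h'
  refine ⟨⟨G₂, hU₂⟩, ⟨G₃, hU₃⟩, ⟨Gx, hUx⟩, ?_, ?_, ?_, ?_, ?_, ?_, ?_⟩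
  · refine (mem_glInt_iff_forall_v_le_one_and_v_det_eq_one G₂).2 ⟨fun i j => ?_, ?_⟩
    · change Valued.v ((!![(0 : w.1.adicCompletion L), 1; 1, 0] : Matrix _ _ _) i j) ≤ 1
      fin_cases i <;> fin_cases j <;> simp
    · change Valued.v ((!![(0 : w.1.adicCompletion L), 1; 1, 0] : Matrix _ _ _).det) = 1
      simp [Matrix.det_fin_two]
  · refine (mem_glInt_iff_forall_v_le_one_and_v_det_eq_one G₃).2 ⟨fun i j => ?_, ?_⟩
    · change Valued.v ((!![(1 : w.1.adicCompletion L), 0; t, 1] : Matrix _ _ _) i j) ≤ 1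
      fin_cases i <;> fin_cases j <;> simp [hvt]
    · change Valued.v ((!![(1 : w.1.adicCompletion L), 0; t, 1] : Matrix _ _ _).det) = 1
      simp [Matrix.det_fin_two]
  · apply hnotS10
    change ¬ Valued.v ((Matrix.diagonal ![(1 : w.1.adicCompletion L), (η : w.1.adicCompletion L)⁻¹] * !![(0 : w.1.adicCompletion L), 1; 1, 0] *
      Matrix.diagonal ![(1 : w.1.adicCompletion L), (η : w.1.adicCompletion L)]) 1 0) ≤ 1
    rw [diagonal_conj_antidiagTwo]; simpa using hvηinv
  · apply hnotS10
    change ¬ Valued.v ((Matrix.diagonal ![(1 : w.1.adicCompletion L), (η : w.1.adicCompletion L)⁻¹] * !![(1 : w.1.adicCompletion L), 0; t, 1] *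
      Matrix.diagonal ![(1 : w.1.adicCompletion L), (η : w.1.adicCompletion L)]) 1 0) ≤ 1
    rw [diagonal_conj_lowerUnipTwo]
    simpa [hvt] using hvηinv
  · apply hnotS10
    rw [Subgroup.coe_mul, Subgroup.coe_inv, Units.val_mul]
    change ¬ Valued.v ((Matrix.diagonal ![(1 : w.1.adicCompletion L), (η : w.1.adicCompletion L)⁻¹] *
      ((!![(0 : w.1.adicCompletion L), 1; 1, 0] : Matrix _ _ _) * !![(1 : w.1.adicCompletion L), 0; t, 1]) *
      Matrix.diagonal ![(1 : w.1.adicCompletion L), (η : w.1.adicCompletion L)]) 1 0) ≤ 1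
    rw [diagonal_conj_antidiagTwo_mul_lowerUnipTwo]; simpa using hvηinv
  · rw [Literature.GroupTheory.mem_map_conj_iff]
    refine (mem_glInt_iff_forall_v_le_one_and_v_det_eq_one _).2 ⟨fun i j => ?_, ?_⟩
    · rw [hconjmat]
      change Valued.v ((Matrix.diagonal ![(1 : w.1.adicCompletion L), (η : w.1.adicCompletion L)⁻¹] *
        !![(0 : w.1.adicCompletion L), (η : w.1.adicCompletion L)⁻¹; galAdicCompletionMap (L := L) (IsCMField.complexConj L) hw (η : w.1.adicCompletion L), 0] *
        Matrix.diagonal ![(1 : w.1.adicCompletion L), (η : w.1.adicCompletion L)]) i j) ≤ 1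
      rw [diagonal_conj_etaAntidiagTwo _ hη0]
      fin_cases i <;> fin_cases j <;> simp
    · rw [hconjmat]
      change Valued.v ((Matrix.diagonal ![(1 : w.1.adicCompletion L), (η : w.1.adicCompletion L)⁻¹] *
        !![(0 : w.1.adicCompletion L), (η : w.1.adicCompletion L)⁻¹; galAdicCompletionMap (L := L) (IsCMField.complexConj L) hw (η : w.1.adicCompletion L), 0] *
        Matrix.diagonal ![(1 : w.1.adicCompletion L), (η : w.1.adicCompletion L)]).det) = 1
      rw [diagonal_conj_etaAntidiagTwo _ hη0]
      simp [Matrix.det_fin_two, hvηση]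
  · apply hnotK01
    change ¬ Valued.v ((!![(0 : w.1.adicCompletion L), (η : w.1.adicCompletion L)⁻¹; galAdicCompletionMap (L := L) (IsCMField.complexConj L) hw (η : w.1.adicCompletion L), 0] :
      Matrix _ _ _) 0 1) ≤ 1
    simpa using hvηinv

include hη in
/-- **TYPE `F_v(√π)` (an anti-fixed `b` with `|b| = |η|⁻¹`, e.g. `b = α⁻¹` for an anti-fixed UNIFORMISER `α`): `n(b) = !![1,b;0,1]`, `x_η` in
`D_η GL₂(𝒪_w) D_η⁻¹ ∩ U_w`, with `n(b)`, `x_η`, `n(b)⁻¹ x_η` outside `GL₂(𝒪_w)`, and `J` in `GL₂(𝒪_w) ∩ U_w` outside `D_η GL₂(𝒪_w) D_η⁻¹`** — three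
`K`-inequivalent elements of the vertex stabiliser `K♯_D` and one element of `K ∖ K♯_D`. [cite: Serre1980Trees, II.1.3] [cite: Tits1979, §2.7] [cite: Kottwitz1988, §2] -/
theorem exists_onePlaceWitnesses_of_antifixed_inv_uniformizer {b : w.1.adicCompletion L}
    (hσb : galAdicCompletionMap (L := L) (IsCMField.complexConj L) hw b = -b) (hvb : Valued.v b = WithZero.exp (1 : ℤ)) :
    ∃ u₂ u₃ x : ↥(unitaryGroupOfForm (galAdicCompletionMap (L := L) (IsCMField.complexConj L) hw)
        (placeForm (Matrix.of fun i j : Fin 2 => if i.val + j.val + 1 = 2 then (1 : L) else 0) w.1)),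
      (u₂ : GL (Fin 2) (w.1.adicCompletion L)) ∈ (glInt 2 (w.1.adicCompletion L)).map (MulAut.conj (glDiagonal 2 (w.1.adicCompletion L) ![1, η])).toMonoidHom ∧
      (u₃ : GL (Fin 2) (w.1.adicCompletion L)) ∈ (glInt 2 (w.1.adicCompletion L)).map (MulAut.conj (glDiagonal 2 (w.1.adicCompletion L) ![1, η])).toMonoidHom ∧
      (u₂ : GL (Fin 2) (w.1.adicCompletion L)) ∉ glInt 2 (w.1.adicCompletion L) ∧ (u₃ : GL (Fin 2) (w.1.adicCompletion L)) ∉ glInt 2 (w.1.adicCompletion L) ∧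
      ((u₂⁻¹ * u₃ : ↥(unitaryGroupOfForm (galAdicCompletionMap (L := L) (IsCMField.complexConj L) hw)
        (placeForm (Matrix.of fun i j : Fin 2 => if i.val + j.val + 1 = 2 then (1 : L) else 0) w.1))) : GL (Fin 2) (w.1.adicCompletion L)) ∉
          glInt 2 (w.1.adicCompletion L) ∧
      (x : GL (Fin 2) (w.1.adicCompletion L)) ∈ glInt 2 (w.1.adicCompletion L) ∧
      (x : GL (Fin 2) (w.1.adicCompletion L)) ∉ (glInt 2 (w.1.adicCompletion L)).map (MulAut.conj (glDiagonal 2 (w.1.adicCompletion L) ![1, η])).toMonoidHom := by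
  classical
  have hc1 : IsCMField.complexConj L ≠ 1 := IsCMField.complexConj_ne_one L
  have hη0 : (η : w.1.adicCompletion L) ≠ 0 := η.ne_zero
  have hση0 : galAdicCompletionMap (L := L) (IsCMField.complexConj L) hw (η : w.1.adicCompletion L) ≠ 0 := by simp
  have hσσ : galAdicCompletionMap (L := L) (IsCMField.complexConj L) hw (galAdicCompletionMap (L := L) (IsCMField.complexConj L) hw (η : w.1.adicCompletion L)) = η :=
    galAdicCompletionMap_galAdicCompletionMap_of_smul_eq (IsCMField.complexConj L) w hc1 hw _
  have hvηinv : ¬ Valued.v ((η : w.1.adicCompletion L)⁻¹) ≤ 1 := by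
    rw [map_inv₀, hη, ← WithZero.exp_neg, ← WithZero.exp_zero, not_le]
    exact WithZero.exp_lt_exp.2 (by norm_num)
  have hvb1 : ¬ Valued.v b ≤ 1 := by
    rw [hvb, ← WithZero.exp_zero, not_le]; exact WithZero.exp_lt_exp.2 (by norm_num)
  have hvbη : Valued.v (b * (η : w.1.adicCompletion L)) = 1 := by
    rw [map_mul, hvb, hη, ← WithZero.exp_add]; norm_num
  have hvηση : Valued.v ((η : w.1.adicCompletion L)⁻¹ * galAdicCompletionMap (L := L) (IsCMField.complexConj L) hw (η : w.1.adicCompletion L)) = 1 := by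
    rw [map_mul, map_inv₀, valued_galAdicCompletionMap, inv_mul_cancel₀]
    rw [hη]; exact WithZero.coe_ne_zero
  have hJ : placeForm (Matrix.of fun i j : Fin 2 => if i.val + j.val + 1 = 2 then (1 : L) else 0) w.1 = !![(0 : w.1.adicCompletion L), 1; 1, 0] := by
    ext i j; fin_cases i <;> fin_cases j <;> simp [placeForm, Matrix.map_apply]
  -- the three one-place matrices
  have hJJ := antidiagTwo_mul_self (F := w.1.adicCompletion L)
  have hNN := upperUnipTwo_mul_neg b
  have hNN' : (!![(1 : w.1.adicCompletion L), -b; 0, 1] : Matrix (Fin 2) (Fin 2) (w.1.adicCompletion L)) * !![(1 : w.1.adicCompletion L), b; 0, 1] = 1 := by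
    simpa using upperUnipTwo_mul_neg (-b)
  have hXX := etaAntidiagTwo_mul hη0 hση0
  have hXX' := etaAntidiagTwo_mul hση0 hη0
  set G₂ : GL (Fin 2) (w.1.adicCompletion L) := ⟨_, _, hNN, hNN'⟩ with hG₂
  set Gx : GL (Fin 2) (w.1.adicCompletion L) := ⟨_, _, hXX, hXX'⟩ with hGx
  set GJ : GL (Fin 2) (w.1.adicCompletion L) := ⟨_, _, hJJ, hJJ⟩ with hGJ
  -- unitarity
  have hmemU : ∀ g : GL (Fin 2) (w.1.adicCompletion L),
      ((g : Matrix (Fin 2) (Fin 2) (w.1.adicCompletion L)).map (galAdicCompletionMap (L := L) (IsCMField.complexConj L) hw))ᵀ *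
          !![(0 : w.1.adicCompletion L), 1; 1, 0] * (g : Matrix (Fin 2) (Fin 2) (w.1.adicCompletion L)) = !![(0 : w.1.adicCompletion L), 1; 1, 0] →
        g ∈ unitaryGroupOfForm (galAdicCompletionMap (L := L) (IsCMField.complexConj L) hw) (placeForm (Matrix.of fun i j : Fin 2 => if i.val + j.val + 1 = 2 then (1 : L) else 0) w.1) := by
    intro g hg; rw [mem_unitaryGroupOfForm_iff, hJ]; exact hg
  have hU₂ := hmemU G₂ (upperUnipTwo_unitary _ hσb)
  have hUx := hmemU Gx (etaAntidiagTwo_unitary _ hη0 hσσ)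
  have hUJ := hmemU GJ (antidiagTwo_unitary _)
  -- conjugation by `D_η` on matrices
  have hconjmat : ∀ g : GL (Fin 2) (w.1.adicCompletion L),
      (((glDiagonal 2 (w.1.adicCompletion L) ![1, η])⁻¹ * g * glDiagonal 2 (w.1.adicCompletion L) ![1, η] : GL (Fin 2) (w.1.adicCompletion L)) :
        Matrix (Fin 2) (Fin 2) (w.1.adicCompletion L)) =
        Matrix.diagonal ![(1 : w.1.adicCompletion L), (η : w.1.adicCompletion L)⁻¹] * (g : Matrix (Fin 2) (Fin 2) (w.1.adicCompletion L)) *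
          Matrix.diagonal ![(1 : w.1.adicCompletion L), (η : w.1.adicCompletion L)] := by
    intro g
    rw [Units.val_mul, Units.val_mul, ← map_inv, coe_glDiagonal, coe_glDiagonal]
    have hd1 : (fun k : Fin 2 => (((![1, η] : Fin 2 → (w.1.adicCompletion L)ˣ)⁻¹ k : (w.1.adicCompletion L)ˣ) : w.1.adicCompletion L)) =
        ![(1 : w.1.adicCompletion L), (η : w.1.adicCompletion L)⁻¹] := by
      funext k; fin_cases k <;> simp
    have hd2 : (fun k : Fin 2 => (((![1, η] : Fin 2 → (w.1.adicCompletion L)ˣ) k : (w.1.adicCompletion L)ˣ) : w.1.adicCompletion L)) =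
        ![(1 : w.1.adicCompletion L), (η : w.1.adicCompletion L)] := by
      funext k; fin_cases k <;> simp
    rw [hd1, hd2]
  have hnotK01 : ∀ g : GL (Fin 2) (w.1.adicCompletion L), ¬ Valued.v ((g : Matrix (Fin 2) (Fin 2) (w.1.adicCompletion L)) 0 1) ≤ 1 → g ∉ glInt 2 (w.1.adicCompletion L) :=
    fun g hg h => hg (((mem_glInt_iff_forall_v_le_one_and_v_det_eq_one g).1 h).1 0 1)
  have hmemS : ∀ g : GL (Fin 2) (w.1.adicCompletion L),
      (∀ i j, Valued.v ((Matrix.diagonal ![(1 : w.1.adicCompletion L), (η : w.1.adicCompletion L)⁻¹] * (g : Matrix (Fin 2) (Fin 2) (w.1.adicCompletion L)) *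
          Matrix.diagonal ![(1 : w.1.adicCompletion L), (η : w.1.adicCompletion L)]) i j) ≤ 1) →
      Valued.v (Matrix.diagonal ![(1 : w.1.adicCompletion L), (η : w.1.adicCompletion L)⁻¹] * (g : Matrix (Fin 2) (Fin 2) (w.1.adicCompletion L)) *
          Matrix.diagonal ![(1 : w.1.adicCompletion L), (η : w.1.adicCompletion L)]).det = 1 →
        g ∈ (glInt 2 (w.1.adicCompletion L)).map (MulAut.conj (glDiagonal 2 (w.1.adicCompletion L) ![1, η])).toMonoidHom := by
    intro g h1 h2
    rw [Literature.GroupTheory.mem_map_conj_iff]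
    refine (mem_glInt_iff_forall_v_le_one_and_v_det_eq_one _).2 ⟨fun i j => ?_, ?_⟩
    · rw [hconjmat]; exact h1 i j
    · rw [hconjmat]; exact h2
  refine ⟨⟨G₂, hU₂⟩, ⟨Gx, hUx⟩, ⟨GJ, hUJ⟩, ?_, ?_, ?_, ?_, ?_, ?_, ?_⟩
  · refine hmemS G₂ (fun i j => ?_) ?_
    · change Valued.v ((Matrix.diagonal ![(1 : w.1.adicCompletion L), (η : w.1.adicCompletion L)⁻¹] * !![(1 : w.1.adicCompletion L), b; 0, 1] *
        Matrix.diagonal ![(1 : w.1.adicCompletion L), (η : w.1.adicCompletion L)]) i j) ≤ 1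
      rw [diagonal_conj_upperUnipTwo _ hη0]
      fin_cases i <;> fin_cases j <;> simp [hvbη]
    · change Valued.v ((Matrix.diagonal ![(1 : w.1.adicCompletion L), (η : w.1.adicCompletion L)⁻¹] * !![(1 : w.1.adicCompletion L), b; 0, 1] *
        Matrix.diagonal ![(1 : w.1.adicCompletion L), (η : w.1.adicCompletion L)]).det) = 1
      rw [diagonal_conj_upperUnipTwo _ hη0]; simp
  · refine hmemS Gx (fun i j => ?_) ?_
    · change Valued.v ((Matrix.diagonal ![(1 : w.1.adicCompletion L), (η : w.1.adicCompletion L)⁻¹] *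
        !![(0 : w.1.adicCompletion L), (η : w.1.adicCompletion L)⁻¹; galAdicCompletionMap (L := L) (IsCMField.complexConj L) hw (η : w.1.adicCompletion L), 0] *
        Matrix.diagonal ![(1 : w.1.adicCompletion L), (η : w.1.adicCompletion L)]) i j) ≤ 1
      rw [diagonal_conj_etaAntidiagTwo _ hη0]
      fin_cases i <;> fin_cases j <;> simp
    · change Valued.v ((Matrix.diagonal ![(1 : w.1.adicCompletion L), (η : w.1.adicCompletion L)⁻¹] *
        !![(0 : w.1.adicCompletion L), (η : w.1.adicCompletion L)⁻¹; galAdicCompletionMap (L := L) (IsCMField.complexConj L) hw (η : w.1.adicCompletion L), 0] *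
        Matrix.diagonal ![(1 : w.1.adicCompletion L), (η : w.1.adicCompletion L)]).det) = 1
      rw [diagonal_conj_etaAntidiagTwo _ hη0]
      simp [Matrix.det_fin_two, hvηση]
  · apply hnotK01
    change ¬ Valued.v ((!![(1 : w.1.adicCompletion L), b; 0, 1] : Matrix _ _ _) 0 1) ≤ 1
    simpa using hvb1
  · apply hnotK01
    change ¬ Valued.v ((!![(0 : w.1.adicCompletion L), (η : w.1.adicCompletion L)⁻¹; galAdicCompletionMap (L := L) (IsCMField.complexConj L) hw (η : w.1.adicCompletion L), 0] :
      Matrix _ _ _) 0 1) ≤ 1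
    simpa using hvηinv
  · apply hnotK01
    rw [Subgroup.coe_mul, Subgroup.coe_inv, Units.val_mul]
    change ¬ Valued.v (((!![(1 : w.1.adicCompletion L), -b; 0, 1] : Matrix _ _ _) *
      !![(0 : w.1.adicCompletion L), (η : w.1.adicCompletion L)⁻¹; galAdicCompletionMap (L := L) (IsCMField.complexConj L) hw (η : w.1.adicCompletion L), 0]) 0 1) ≤ 1
    rw [upperUnipTwo_neg_mul_etaAntidiagTwo]; simpa using hvηinv
  · refine (mem_glInt_iff_forall_v_le_one_and_v_det_eq_one GJ).2 ⟨fun i j => ?_, ?_⟩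
    · change Valued.v ((!![(0 : w.1.adicCompletion L), 1; 1, 0] : Matrix _ _ _) i j) ≤ 1
      fin_cases i <;> fin_cases j <;> simp
    · change Valued.v ((!![(0 : w.1.adicCompletion L), 1; 1, 0] : Matrix _ _ _).det) = 1
      simp [Matrix.det_fin_two]
  · intro h
    have h' := ((mem_glInt_iff_forall_v_le_one_and_v_det_eq_one _).1 ((Literature.GroupTheory.mem_map_conj_iff _ _ _).1 h)).1 1 0
    rw [hconjmat] at h'
    change Valued.v ((Matrix.diagonal ![(1 : w.1.adicCompletion L), (η : w.1.adicCompletion L)⁻¹] * !![(0 : w.1.adicCompletion L), 1; 1, 0] *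
      Matrix.diagonal ![(1 : w.1.adicCompletion L), (η : w.1.adicCompletion L)]) 1 0) ≤ 1 at h'
    rw [diagonal_conj_antidiagTwo] at h'
    exact hvηinv (by simpa using h')

end Witnesses

end Literature.NumberTheory.Rogawski1990

end
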